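import Mathlib
import HarnessLib
import Summits.HubbardSuperconductivity.HubbardSuperconductivity.Theorems.KLProgrammeKLRegimeEngineFrameShiftDressingFactorTables
import Literature.MathematicalPhysics.QuantumLattice.HubbardUVSymbolDressingFactorJetsGevrey

/-!
# K3 gen-8-FLOW (stmt 20437, stub (C), «(C)-B-REP»/«(C)-B-ALIAS-L», sup route): the DRESSING-FACTOR TABLES at the flow frames, v2 —
# SATISFIABLE (Θ, Φ, Ξ)-parametrised envelopes and GEVREY-2 factor jets with ratios free of the cutoff table's growth

Cell gate-hubbard-kl, seat p2 g14.  v1 (`…EngineFrameShiftDressingFactorTables`, p576420) asked the mismatch envelope `S₀·16^{−m} ≤ δ ≤ Λ_m/4`, EMPTY in the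
engine's regime (self-audit F1: `S₀ ∋ π⁸WU² ≈ 2^{31}X` at the raised constants), and read the cutoff through a flat table `X` whose growth `X_N ∼ (N!)²` sat in
every ratio (F2).  Here: (i) the band/mismatch envelopes are PARAMETRISED — `E_u = 4 + 4^m·Ξ`, `F_v = 2^{10}Φ·4^m`, `δ = Gfr₀|U|Θ·16^{−m}` under the m-FREE
table hypotheses `A_i ≤ i!·Ξⁱ` (`1 ≤ i`) and `A_i ≤ Gfr₀|U|Θ·i!·(2^{10}Φ)ⁱ` (all `i`; `A_i` the piece table of p574033 with the ORDER-4 cutoff constant `X₄`) —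
satisfiable for every `U` (choose `Ξ, Φ, Θ` large), with `δ ≤ Λ_m/4` a separate hypothesis (room `Θ ≤ 4^m·klE0/(4Gfr₀|U|)`); (ii) the factor jets are the
GEVREY-2 ones (`Literature.….HubbardUVSymbolResummedBandJetsGevrey` / `…DressingFactorJetsGevrey`, cutoff table `‖χ₂^{(l)}‖ ≤ X₀(l!)²C_χ^l`):
`frameLevel_flowFrame_jets_of_env`, `flowMismatch_jets_of_env`, and the six tables `norm_iteratedFDeriv_{resummed,symbolOld,defect,kappaPsi,J₂,J₁}_flowFrame_le_gevrey`
(`(k!)²` growth).  Proofs only; nothing about the model's sizes is asserted; nothing asserts superconductivity.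
References: BGM 2006 §2.2 (2.23), (2.27)–(2.28), (2.36aa), §3 (3.2) [cite: BenfattoGiulianiMastropietro2006].
-/

noncomputable section

namespace Summit.HubbardSuperconductivity.HubbardSuperconductivity.Theorems.EngineV8

set_option linter.dupNamespace false -- summit = problem name (single-conjunct summit), D-0017

open Real Finset Literature.MathematicalPhysics.QuantumLattice Literature.Probability.LatticeModels
open Summit.HubbardSuperconductivity.HubbardSuperconductivity.Theorems.KLRegimeSplit
open Summit.HubbardSuperconductivity.HubbardSuperconductivity.Theorems.DispersionFlow
open Summit.HubbardSuperconductivity.HubbardSuperconductivity.Theorems.KLProgrammeLegKernels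
open scoped Nat

variable {L M : ℕ} [NeZero L] [NeZero M]

/-! ## §1 Parametrised envelopes of the band and mismatch jets at the flow frames -/

/-- **THE BAND ENVELOPE, PARAMETRISED**: if the piece table satisfies `A_i ≤ i!·Ξⁱ` for `1 ≤ i` then `‖Dⁱ e_{K_{m+1}}(q)‖ ≤ i!·(4 + 4^m·Ξ)ⁱ` for all `1 ≤ i`, `q`.
[cite: BenfattoGiulianiMastropietro2006, §3 (3.2)] -/
theorem frameLevel_flowFrame_jets_of_env {G : GeoConsts} {Q : EngConsts} {R : RenConsts} (hR : ∀ j, 0 ≤ R.Gfr j) (hGS : ∀ k, 0 ≤ G.S k)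
    (hQS : ∀ k, 0 ≤ Q.S' k) {β U μ : ℝ} (hμ : μ ∈ klWindowC) {X₄ : ℝ} (hX4 : ∀ l ≤ 4, ∀ x : ℝ, ‖iteratedFDeriv ℝ l salmhoferCutoff x‖ ≤ X₄)
    {n : ℕ} (hP : ∀ m ≤ n, FlowPieceJetsAt L M β U μ R m) (hT : ∀ m ≤ n, TwoLegReadJetsF L M G Q β U μ m)
    {m : ℕ} (hmn : m ≤ n) {Ξ : ℝ} (hΞ0 : 0 ≤ Ξ) (hΞ : ∀ i, 1 ≤ i → (if i ≤ 4 then R.Gfr i * uPow i U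
      else 2 ^ i * (Real.pi ^ 8 / 4 * 2 ^ (i - 1) * (2 : ℝ) ^ (8 * (i - 1))) *
        ((curveExtC X₄ G.S 1 + curveExtC X₄ Q.S' 1 * |U|) * U ^ 2)) ≤ i ! * Ξ ^ i) {i : ℕ} (hi : 1 ≤ i) (q : Momentum) :
    ‖iteratedFDeriv ℝ i (frameLevel μ (klFlowFrameU L M β U μ (m + 1))) q‖ ≤ i ! * (4 + (4 : ℝ) ^ m * Ξ) ^ i := by
  have hX0 : 0 ≤ X₄ := (norm_nonneg _).trans (hX4 0 (by norm_num) 0)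
  set A : ℝ := (if i ≤ 4 then R.Gfr i * uPow i U
      else 2 ^ i * (Real.pi ^ 8 / 4 * 2 ^ (i - 1) * (2 : ℝ) ^ (8 * (i - 1))) *
        ((curveExtC X₄ G.S 1 + curveExtC X₄ Q.S' 1 * |U|) * U ^ 2)) with hA
  have hA0 : 0 ≤ A := flowPiece_tableA_nonneg hR hGS hQS hX0 U i
  have h := frameLevel_flowFrame_jets_allOrders (L := L) (M := M) hGS hQS hμ hX4 hP hT (m := m + 1) (by omega) hi q
  have hsum : ∑ m' ∈ range (m + 1), A * (4 : ℝ) ^ (((i : ℤ) - 2) * m') ≤ A * (4 : ℝ) ^ (i * m) := by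
    calc ∑ m' ∈ range (m + 1), A * (4 : ℝ) ^ (((i : ℤ) - 2) * m') ≤ ∑ m' ∈ range (m + 1), A * (4 : ℝ) ^ ((i - 1) * m) :=
          sum_le_sum fun m' hm' => mul_le_mul_of_nonneg_left (four_zpow_order_le_pow hi (by simp at hm'; omega)) hA0
      _ = ((m + 1 : ℕ) : ℝ) * (A * (4 : ℝ) ^ ((i - 1) * m)) := by rw [sum_const, card_range, nsmul_eq_mul]
      _ ≤ (4 : ℝ) ^ m * (A * (4 : ℝ) ^ ((i - 1) * m)) := by
          refine mul_le_mul_of_nonneg_right ?_ (by positivity)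
          exact_mod_cast (Nat.lt_pow_self (by norm_num : 1 < 4) : m < 4 ^ m)
      _ = A * (4 : ℝ) ^ (i * m) := by
          obtain ⟨k, rfl⟩ : ∃ k, i = k + 1 := ⟨i - 1, by omega⟩
          rw [Nat.add_sub_cancel, mul_left_comm, ← pow_add]
          ring_nf
  have hfac : (1 : ℝ) ≤ i ! := by exact_mod_cast Nat.one_le_iff_ne_zero.2 (Nat.factorial_ne_zero i)
  have hmain : (4 : ℝ) ^ i + A * (4 : ℝ) ^ (i * m) ≤ i ! * (4 + (4 : ℝ) ^ m * Ξ) ^ i := by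
    have h1 : A * (4 : ℝ) ^ (i * m) ≤ i ! * ((4 : ℝ) ^ m * Ξ) ^ i := by
      rw [mul_pow, ← pow_mul, mul_comm m i]
      calc A * (4 : ℝ) ^ (i * m) ≤ (i ! * Ξ ^ i) * (4 : ℝ) ^ (i * m) := mul_le_mul_of_nonneg_right (hΞ i hi) (by positivity)
        _ = i ! * ((4 : ℝ) ^ (i * m) * Ξ ^ i) := by ring
    have h2 : (4 : ℝ) ^ i ≤ i ! * (4 : ℝ) ^ i := le_mul_of_one_le_left (by positivity) hfac
    calc (4 : ℝ) ^ i + A * (4 : ℝ) ^ (i * m) ≤ i ! * (4 : ℝ) ^ i + i ! * ((4 : ℝ) ^ m * Ξ) ^ i := add_le_add h2 h1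
      _ = i ! * ((4 : ℝ) ^ i + ((4 : ℝ) ^ m * Ξ) ^ i) := by ring
      _ ≤ i ! * (4 + (4 : ℝ) ^ m * Ξ) ^ i :=
          mul_le_mul_of_nonneg_left (pow_add_pow_le (by norm_num) (mul_nonneg (by positivity) hΞ0) (by omega)) (by positivity)
  exact h.trans ((add_le_add le_rfl hsum).trans hmain)

/-- **THE MISMATCH ENVELOPE, PARAMETRISED**: if `A_i ≤ Gfr₀|U|Θ·i!·(2^{10}Φ)ⁱ` for all `i` then `‖Dⁱ evalM (K_{m+1} ⊖ K_m)(q)‖ ≤ (Gfr₀|U|Θ·16^{−m})·i!·(2^{10}Φ·4^m)ⁱ`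
for EVERY `i` and `q` (`i = 0`: `|v| ≤ δ`). [cite: BenfattoGiulianiMastropietro2006, §3 (3.2)] -/
theorem flowMismatch_jets_of_env {G : GeoConsts} {Q : EngConsts} {R : RenConsts} (hGS : ∀ k, 0 ≤ G.S k)
    (hQS : ∀ k, 0 ≤ Q.S' k) {β U μ : ℝ} (hμ : μ ∈ klWindowC) {X₄ : ℝ} (hX4 : ∀ l ≤ 4, ∀ x : ℝ, ‖iteratedFDeriv ℝ l salmhoferCutoff x‖ ≤ X₄)
    {n : ℕ} (hP : ∀ m ≤ n, FlowPieceJetsAt L M β U μ R m) (hT : ∀ m ≤ n, TwoLegReadJetsF L M G Q β U μ m)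
    {m : ℕ} (hmn : m ≤ n) {Θ Φ : ℝ} (hΘΦ : ∀ i : ℕ, (if i ≤ 4 then R.Gfr i * uPow i U
      else 2 ^ i * (Real.pi ^ 8 / 4 * 2 ^ (i - 1) * (2 : ℝ) ^ (8 * (i - 1))) *
        ((curveExtC X₄ G.S 1 + curveExtC X₄ Q.S' 1 * |U|) * U ^ 2)) ≤ R.Gfr 0 * |U| * Θ * i ! * (2 ^ 10 * Φ) ^ i)
    (i : ℕ) (q : Momentum) :
    ‖iteratedFDeriv ℝ i (evalM (fsub (klFlowFrameU L M β U μ (m + 1)) (klFlowFrameU L M β U μ m))) q‖ ≤ (R.Gfr 0 * |U| * Θ * ((16 : ℝ) ^ m)⁻¹) * i ! * (2 ^ 10 * Φ * (4 : ℝ) ^ m) ^ i := by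
  have hfun : evalM (fsub (klFlowFrameU L M β U μ (m + 1)) (klFlowFrameU L M β U μ m)) = -evalM (klFlowPiece L M β U μ m) := by
    funext q
    rw [Pi.neg_apply, evalM_fsub, klFlowFrameU_succ, evalM_fsub]
    ring
  rw [hfun, iteratedFDeriv_neg_apply, norm_neg]
  refine (flowPiece_jets_allOrders hGS hQS hμ hX4 hP hT m hmn i q).trans ?_
  rw [four_zpow_order_eq_inv_mul_pow]
  calc (if i ≤ 4 then R.Gfr i * uPow i U
      else 2 ^ i * (Real.pi ^ 8 / 4 * 2 ^ (i - 1) * (2 : ℝ) ^ (8 * (i - 1))) *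
        ((curveExtC X₄ G.S 1 + curveExtC X₄ Q.S' 1 * |U|) * U ^ 2)) * (((16 : ℝ) ^ m)⁻¹ * (4 : ℝ) ^ (i * m))
      ≤ (R.Gfr 0 * |U| * Θ * i ! * (2 ^ 10 * Φ) ^ i) * (((16 : ℝ) ^ m)⁻¹ * (4 : ℝ) ^ (i * m)) := mul_le_mul_of_nonneg_right (hΘΦ i) (by positivity)
    _ = (R.Gfr 0 * |U| * Θ * ((16 : ℝ) ^ m)⁻¹) * i ! * (2 ^ 10 * Φ * (4 : ℝ) ^ m) ^ i := by rw [pow_mul', mul_pow, mul_pow]; ring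

/-! ## §2 The Gevrey-2 dressing-factor tables at the flow frames -/

section Tables

omit [NeZero L] [NeZero M] in
/-- `0 < Λ_m`. -/
private theorem klScale_pos'' (m : ℕ) : 0 < klScale klE0 m := by unfold klScale klE0; positivity

variable {G : GeoConsts} {Q : EngConsts} {R : RenConsts} (hR : ∀ j, 0 ≤ R.Gfr j) (hGS : ∀ k, 0 ≤ G.S k) (hQS : ∀ k, 0 ≤ Q.S' k)
  {β U μ : ℝ} (hμ : μ ∈ klWindowC) {X₄ : ℝ} (hX4 : ∀ l ≤ 4, ∀ x : ℝ, ‖iteratedFDeriv ℝ l salmhoferCutoff x‖ ≤ X₄)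
  {N : ℕ} {X₀ Cχ : ℝ} (hX1 : 1 ≤ X₀) (hC : 0 ≤ Cχ) (hXG : ∀ l ≤ N, ∀ x : ℝ, ‖iteratedFDeriv ℝ l salmhoferCutoff x‖ ≤ X₀ * ((l ! : ℝ)) ^ 2 * Cχ ^ l)
  {n : ℕ} (hP : ∀ m ≤ n, FlowPieceJetsAt L M β U μ R m) (hT : ∀ m ≤ n, TwoLegReadJetsF L M G Q β U μ m) {m : ℕ} (hmn : m ≤ n)
  {Ξ Θ Φ : ℝ} (hΞ0 : 0 ≤ Ξ) (hΘ0 : 0 ≤ Θ) (hΦ0 : 0 ≤ Φ) (hΞ : ∀ i, 1 ≤ i → (if i ≤ 4 then R.Gfr i * uPow i U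
      else 2 ^ i * (Real.pi ^ 8 / 4 * 2 ^ (i - 1) * (2 : ℝ) ^ (8 * (i - 1))) *
        ((curveExtC X₄ G.S 1 + curveExtC X₄ Q.S' 1 * |U|) * U ^ 2)) ≤ i ! * Ξ ^ i)
  (hΘΦ : ∀ i : ℕ, (if i ≤ 4 then R.Gfr i * uPow i U
      else 2 ^ i * (Real.pi ^ 8 / 4 * 2 ^ (i - 1) * (2 : ℝ) ^ (8 * (i - 1))) *
        ((curveExtC X₄ G.S 1 + curveExtC X₄ Q.S' 1 * |U|) * U ^ 2)) ≤ R.Gfr 0 * |U| * Θ * i ! * (2 ^ 10 * Φ) ^ i)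
  (hδΛ : (R.Gfr 0 * |U| * Θ * ((16 : ℝ) ^ m)⁻¹) ≤ (klScale klE0 m) / 4) {ω : ℝ} (hω : ω ≠ 0) (c : ℝ)
include hR hGS hQS hμ hX4 hX1 hC hXG hP hT hmn hΞ0 hΘ0 hΦ0 hΞ hΘΦ hδΛ hω

/-- **TABLE (resummed), Gevrey-2, parametrised envelopes.** [cite: BenfattoGiulianiMastropietro2006, §2.2 (2.23)] -/
theorem norm_iteratedFDeriv_resummed_flowFrame_le_gevrey {k : ℕ} (hk : k ≤ N) (q : Momentum) :
    ‖iteratedFDeriv ℝ k (fun q : Momentum => ((uvWeightFn (klScale klE0 m) ω (frameLevel μ (klFlowFrameU L M β U μ (m + 1)) q) : ℝ) : ℂ) * resolventFnXi c 0 ω (frameLevel μ (klFlowFrameU L M β U μ (m + 1)) q + uvWeightFn (klScale klE0 m) ω (frameLevel μ (klFlowFrameU L M β U μ (m + 1)) q) * evalM (fsub (klFlowFrameU L M β U μ (m + 1)) (klFlowFrameU L M β U μ m)) q)) q‖ ≤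
      X₀ * (|c| * (6 / (klScale klE0 m))) * ((k ! : ℝ)) ^ 2 * (2 * (4 * (2 * (4 * (4 + (4 : ℝ) ^ m * Ξ) * (1 + 16 * (1 + Cχ) / (klScale klE0 m) * 1) + (2 ^ 10 * Φ * (4 : ℝ) ^ m))) * (1 + 6 / (klScale klE0 m) * ((klScale klE0 m) / 128 + X₀ * (R.Gfr 0 * |U| * Θ * ((16 : ℝ) ^ m)⁻¹))))) ^ k := by
  have hδ0 : 0 ≤ (R.Gfr 0 * |U| * Θ * ((16 : ℝ) ^ m)⁻¹) := mul_nonneg (mul_nonneg (mul_nonneg (hR 0) (abs_nonneg U)) hΘ0) (by positivity)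
  exact norm_iteratedFDeriv_uvResummed_comp_le_gevrey (klScale_pos'' m) hω hX1 hC (fun l hl x => hXG l (hl.trans hk) x)
    (EngineV8.contDiff_frameLevel μ _) (contDiff_evalM _) (add_nonneg (by norm_num) (mul_nonneg (by positivity) hΞ0)) (mul_nonneg (mul_nonneg (by norm_num) hΦ0) (by positivity)) hδ0 hδΛ q
    (by have h0 := flowMismatch_jets_of_env hGS hQS hμ hX4 hP hT hmn hΘΦ 0 q
        rw [norm_iteratedFDeriv_zero, Real.norm_eq_abs, Nat.factorial_zero, Nat.cast_one, mul_one, pow_zero, mul_one] at h0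
        exact h0)
    (fun i hi1 _ => frameLevel_flowFrame_jets_of_env hR hGS hQS hμ hX4 hP hT hmn hΞ0 hΞ hi1 q)
    (fun i _ => flowMismatch_jets_of_env hGS hQS hμ hX4 hP hT hmn hΘΦ i q)

omit hδΛ in
/-- **TABLE (symbolOld), Gevrey-2, parametrised envelopes.** [cite: BenfattoGiulianiMastropietro2006, §2.2 (2.23)] -/
theorem norm_iteratedFDeriv_symbolOld_flowFrame_le_gevrey {k : ℕ} (hk : k ≤ N) (q : Momentum) :
    ‖iteratedFDeriv ℝ k (fun q : Momentum => uvSymbolFnXi c (klScale klE0 m) ω (frameLevel μ (klFlowFrameU L M β U μ (m + 1)) q + evalM (fsub (klFlowFrameU L M β U μ (m + 1)) (klFlowFrameU L M β U μ m)) q)) q‖ ≤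
      X₀ * (|c| * (2 / (klScale klE0 m))) * ((k ! : ℝ)) ^ 2 * (4 * ((4 + (4 : ℝ) ^ m * Ξ) + (2 ^ 10 * Φ * (4 : ℝ) ^ m)) * (1 + 2 * (16 * (1 + Cχ) / (klScale klE0 m)) * (1 + (R.Gfr 0 * |U| * Θ * ((16 : ℝ) ^ m)⁻¹)))) ^ k := by
  have hδ0 : 0 ≤ (R.Gfr 0 * |U| * Θ * ((16 : ℝ) ^ m)⁻¹) := mul_nonneg (mul_nonneg (mul_nonneg (hR 0) (abs_nonneg U)) hΘ0) (by positivity)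
  exact norm_iteratedFDeriv_uvSymbol_comp_le_gevrey (klScale_pos'' m) hω hX1 hC (fun l hl x => hXG l (hl.trans hk) x)
    (EngineV8.contDiff_frameLevel μ _) (contDiff_evalM _) (add_nonneg (by norm_num) (mul_nonneg (by positivity) hΞ0)) (mul_nonneg (mul_nonneg (by norm_num) hΦ0) (by positivity)) hδ0 q
    (fun i hi1 _ => frameLevel_flowFrame_jets_of_env hR hGS hQS hμ hX4 hP hT hmn hΞ0 hΞ hi1 q)
    (fun i _ => flowMismatch_jets_of_env hGS hQS hμ hX4 hP hT hmn hΘΦ i q)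

/-- **TABLE (defect), Gevrey-2, parametrised envelopes.** [cite: BenfattoGiulianiMastropietro2006, §2.2 (2.23)] -/
theorem norm_iteratedFDeriv_defect_flowFrame_le_gevrey {k : ℕ} (hk : k ≤ N) (q : Momentum) :
    ‖iteratedFDeriv ℝ k (fun q : Momentum => ((uvWeightFn (klScale klE0 m) ω (frameLevel μ (klFlowFrameU L M β U μ (m + 1)) q) : ℝ) : ℂ) * resolventFnXi c 0 ω (frameLevel μ (klFlowFrameU L M β U μ (m + 1)) q + uvWeightFn (klScale klE0 m) ω (frameLevel μ (klFlowFrameU L M β U μ (m + 1)) q) * evalM (fsub (klFlowFrameU L M β U μ (m + 1)) (klFlowFrameU L M β U μ m)) q) - uvSymbolFnXi c (klScale klE0 m) ω (frameLevel μ (klFlowFrameU L M β U μ (m + 1)) q + evalM (fsub (klFlowFrameU L M β U μ (m + 1)) (klFlowFrameU L M β U μ m)) q)) q‖ ≤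
      X₀ * (|c| * (6 / (klScale klE0 m))) * ((k ! : ℝ)) ^ 2 * (2 * (4 * (2 * (4 * (4 + (4 : ℝ) ^ m * Ξ) * (1 + 16 * (1 + Cχ) / (klScale klE0 m) * 1) + (2 ^ 10 * Φ * (4 : ℝ) ^ m))) * (1 + 6 / (klScale klE0 m) * ((klScale klE0 m) / 128 + X₀ * (R.Gfr 0 * |U| * Θ * ((16 : ℝ) ^ m)⁻¹))))) ^ k +
        X₀ * (|c| * (2 / (klScale klE0 m))) * ((k ! : ℝ)) ^ 2 * (4 * ((4 + (4 : ℝ) ^ m * Ξ) + (2 ^ 10 * Φ * (4 : ℝ) ^ m)) * (1 + 2 * (16 * (1 + Cχ) / (klScale klE0 m)) * (1 + (R.Gfr 0 * |U| * Θ * ((16 : ℝ) ^ m)⁻¹)))) ^ k := by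
  have hδ0 : 0 ≤ (R.Gfr 0 * |U| * Θ * ((16 : ℝ) ^ m)⁻¹) := mul_nonneg (mul_nonneg (mul_nonneg (hR 0) (abs_nonneg U)) hΘ0) (by positivity)
  exact norm_iteratedFDeriv_defect_le_gevrey (klScale_pos'' m) hω hX1 hC (fun l hl x => hXG l (hl.trans hk) x)
    (EngineV8.contDiff_frameLevel μ _) (contDiff_evalM _) (add_nonneg (by norm_num) (mul_nonneg (by positivity) hΞ0)) (mul_nonneg (mul_nonneg (by norm_num) hΦ0) (by positivity)) hδ0 hδΛ q
    (by have h0 := flowMismatch_jets_of_env hGS hQS hμ hX4 hP hT hmn hΘΦ 0 q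
        rw [norm_iteratedFDeriv_zero, Real.norm_eq_abs, Nat.factorial_zero, Nat.cast_one, mul_one, pow_zero, mul_one] at h0
        exact h0)
    (fun i hi1 _ => frameLevel_flowFrame_jets_of_env hR hGS hQS hμ hX4 hP hT hmn hΞ0 hΞ hi1 q)
    (fun i _ => flowMismatch_jets_of_env hGS hQS hμ hX4 hP hT hmn hΘΦ i q)

/-- **TABLE (kappaPsi), Gevrey-2, parametrised envelopes.** [cite: BenfattoGiulianiMastropietro2006, §2.2 (2.23)] -/
theorem norm_iteratedFDeriv_kappaPsi_flowFrame_le_gevrey {k : ℕ} (hk : k ≤ N) (q : Momentum) :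
    ‖iteratedFDeriv ℝ k (fun q : Momentum => ((((evalM (fsub (klFlowFrameU L M β U μ (m + 1)) (klFlowFrameU L M β U μ m)) q / c : ℝ)) : ℂ) * (((uvWeightFn (klScale klE0 m) ω (frameLevel μ (klFlowFrameU L M β U μ (m + 1)) q) : ℝ) : ℂ) * resolventFnXi c 0 ω (frameLevel μ (klFlowFrameU L M β U μ (m + 1)) q + uvWeightFn (klScale klE0 m) ω (frameLevel μ (klFlowFrameU L M β U μ (m + 1)) q) * evalM (fsub (klFlowFrameU L M β U μ (m + 1)) (klFlowFrameU L M β U μ m)) q)))) q‖ ≤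
      ((R.Gfr 0 * |U| * Θ * ((16 : ℝ) ^ m)⁻¹) / |c|) * (X₀ * (|c| * (6 / (klScale klE0 m)))) * ((k ! : ℝ)) ^ 2 * (2 * (2 * (2 ^ 10 * Φ * (4 : ℝ) ^ m) + 2 * (4 * (2 * (4 * (4 + (4 : ℝ) ^ m * Ξ) * (1 + 16 * (1 + Cχ) / (klScale klE0 m) * 1) + (2 ^ 10 * Φ * (4 : ℝ) ^ m))) * (1 + 6 / (klScale klE0 m) * ((klScale klE0 m) / 128 + X₀ * (R.Gfr 0 * |U| * Θ * ((16 : ℝ) ^ m)⁻¹)))))) ^ k := by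
  have hδ0 : 0 ≤ (R.Gfr 0 * |U| * Θ * ((16 : ℝ) ^ m)⁻¹) := mul_nonneg (mul_nonneg (mul_nonneg (hR 0) (abs_nonneg U)) hΘ0) (by positivity)
  exact norm_iteratedFDeriv_kappaPsi_le_gevrey (klScale_pos'' m) hω hX1 hC (fun l hl x => hXG l (hl.trans hk) x)
    (EngineV8.contDiff_frameLevel μ _) (contDiff_evalM _) (add_nonneg (by norm_num) (mul_nonneg (by positivity) hΞ0)) (mul_nonneg (mul_nonneg (by norm_num) hΦ0) (by positivity)) hδ0 hδΛ q
    (by have h0 := flowMismatch_jets_of_env hGS hQS hμ hX4 hP hT hmn hΘΦ 0 q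
        rw [norm_iteratedFDeriv_zero, Real.norm_eq_abs, Nat.factorial_zero, Nat.cast_one, mul_one, pow_zero, mul_one] at h0
        exact h0)
    (fun i hi1 _ => frameLevel_flowFrame_jets_of_env hR hGS hQS hμ hX4 hP hT hmn hΞ0 hΞ hi1 q)
    (fun i _ => flowMismatch_jets_of_env hGS hQS hμ hX4 hP hT hmn hΘΦ i q)

/-- **TABLE (J₂), Gevrey-2, parametrised envelopes.** [cite: BenfattoGiulianiMastropietro2006, §2.2 (2.23)] -/
theorem norm_iteratedFDeriv_J₂_flowFrame_le_gevrey {k : ℕ} (hk : k ≤ N) (q : Momentum) :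
    ‖iteratedFDeriv ℝ k (fun q : Momentum => -((((evalM (fsub (klFlowFrameU L M β U μ (m + 1)) (klFlowFrameU L M β U μ m)) q * evalM (fsub (klFlowFrameU L M β U μ (m + 1)) (klFlowFrameU L M β U μ m)) q) / c : ℝ)) : ℂ) * (((uvWeightFn (klScale klE0 m) ω (frameLevel μ (klFlowFrameU L M β U μ (m + 1)) q) : ℝ) : ℂ) * resolventFnXi c 0 ω (frameLevel μ (klFlowFrameU L M β U μ (m + 1)) q + uvWeightFn (klScale klE0 m) ω (frameLevel μ (klFlowFrameU L M β U μ (m + 1)) q) * evalM (fsub (klFlowFrameU L M β U μ (m + 1)) (klFlowFrameU L M β U μ m)) q))) q‖ ≤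
      ((R.Gfr 0 * |U| * Θ * ((16 : ℝ) ^ m)⁻¹) * (R.Gfr 0 * |U| * Θ * ((16 : ℝ) ^ m)⁻¹) / |c|) * (X₀ * (|c| * (6 / (klScale klE0 m)))) * ((k ! : ℝ)) ^ 2 * (2 * (2 * (2 ^ 10 * Φ * (4 : ℝ) ^ m) + 2 * (4 * (2 * (4 * (4 + (4 : ℝ) ^ m * Ξ) * (1 + 16 * (1 + Cχ) / (klScale klE0 m) * 1) + (2 ^ 10 * Φ * (4 : ℝ) ^ m))) * (1 + 6 / (klScale klE0 m) * ((klScale klE0 m) / 128 + X₀ * (R.Gfr 0 * |U| * Θ * ((16 : ℝ) ^ m)⁻¹)))))) ^ k := by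
  have hδ0 : 0 ≤ (R.Gfr 0 * |U| * Θ * ((16 : ℝ) ^ m)⁻¹) := mul_nonneg (mul_nonneg (mul_nonneg (hR 0) (abs_nonneg U)) hΘ0) (by positivity)
  exact norm_iteratedFDeriv_J₂_le_gevrey (klScale_pos'' m) hω hX1 hC (fun l hl x => hXG l (hl.trans hk) x)
    (EngineV8.contDiff_frameLevel μ _) (contDiff_evalM _) (add_nonneg (by norm_num) (mul_nonneg (by positivity) hΞ0)) (mul_nonneg (mul_nonneg (by norm_num) hΦ0) (by positivity)) hδ0 hδΛ q
    (by have h0 := flowMismatch_jets_of_env hGS hQS hμ hX4 hP hT hmn hΘΦ 0 q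
        rw [norm_iteratedFDeriv_zero, Real.norm_eq_abs, Nat.factorial_zero, Nat.cast_one, mul_one, pow_zero, mul_one] at h0
        exact h0)
    (fun i hi1 _ => frameLevel_flowFrame_jets_of_env hR hGS hQS hμ hX4 hP hT hmn hΞ0 hΞ hi1 q)
    (fun i _ => flowMismatch_jets_of_env hGS hQS hμ hX4 hP hT hmn hΘΦ i q)

/-- **TABLE (J₁), Gevrey-2, parametrised envelopes.** [cite: BenfattoGiulianiMastropietro2006, §2.2 (2.23)] -/
theorem norm_iteratedFDeriv_J₁_flowFrame_le_gevrey {k : ℕ} (hk : k ≤ N) (q : Momentum) :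
    ‖iteratedFDeriv ℝ k (fun q : Momentum => ((((evalM (fsub (klFlowFrameU L M β U μ (m + 1)) (klFlowFrameU L M β U μ m)) q / c : ℝ)) : ℂ) * (((uvWeightFn (klScale klE0 m) ω (frameLevel μ (klFlowFrameU L M β U μ (m + 1)) q) : ℝ) : ℂ) * resolventFnXi c 0 ω (frameLevel μ (klFlowFrameU L M β U μ (m + 1)) q + uvWeightFn (klScale klE0 m) ω (frameLevel μ (klFlowFrameU L M β U μ (m + 1)) q) * evalM (fsub (klFlowFrameU L M β U μ (m + 1)) (klFlowFrameU L M β U μ m)) q))) * ((((evalM (fsub (klFlowFrameU L M β U μ (m + 1)) (klFlowFrameU L M β U μ m)) q / c : ℝ)) : ℂ) * (((uvWeightFn (klScale klE0 m) ω (frameLevel μ (klFlowFrameU L M β U μ (m + 1)) q) : ℝ) : ℂ) * resolventFnXi c 0 ω (frameLevel μ (klFlowFrameU L M β U μ (m + 1)) q + uvWeightFn (klScale klE0 m) ω (frameLevel μ (klFlowFrameU L M β U μ (m + 1)) q) * evalM (fsub (klFlowFrameU L M β U μ (m + 1)) (klFlowFrameU L M β U μ m)) q))) - (2 : ℂ)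 * ((((evalM (fsub (klFlowFrameU L M β U μ (m + 1)) (klFlowFrameU L M β U μ m)) q / c : ℝ)) : ℂ) * (((uvWeightFn (klScale klE0 m) ω (frameLevel μ (klFlowFrameU L M β U μ (m + 1)) q) : ℝ) : ℂ) * resolventFnXi c 0 ω (frameLevel μ (klFlowFrameU L M β U μ (m + 1)) q + uvWeightFn (klScale klE0 m) ω (frameLevel μ (klFlowFrameU L M β U μ (m + 1)) q) * evalM (fsub (klFlowFrameU L M β U μ (m + 1)) (klFlowFrameU L M β U μ m)) q)))) q‖ ≤
      ((R.Gfr 0 * |U| * Θ * ((16 : ℝ) ^ m)⁻¹) / |c| * (X₀ * (|c| * (6 / (klScale klE0 m))))) * ((R.Gfr 0 * |U| * Θ * ((16 : ℝ) ^ m)⁻¹) / |c| * (X₀ * (|c| * (6 / (klScale klE0 m))))) * ((k ! : ℝ)) ^ 2 * (2 * (2 * (2 * (2 ^ 10 * Φ * (4 : ℝ) ^ m) + 2 * (4 * (2 * (4 * (4 + (4 : ℝ) ^ m * Ξ) * (1 + 16 * (1 + Cχ) / (klScale klE0 m) * 1) + (2 ^ 10 * Φ * (4 : ℝ) ^ m)))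 * (1 + 6 / (klScale klE0 m) * ((klScale klE0 m) / 128 + X₀ * (R.Gfr 0 * |U| * Θ * ((16 : ℝ) ^ m)⁻¹))))))) ^ k + 2 * (((R.Gfr 0 * |U| * Θ * ((16 : ℝ) ^ m)⁻¹) / |c|) * (X₀ * (|c| * (6 / (klScale klE0 m)))) * ((k ! : ℝ)) ^ 2 * (2 * (2 * (2 ^ 10 * Φ * (4 : ℝ) ^ m) + 2 * (4 * (2 * (4 * (4 + (4 : ℝ) ^ m * Ξ) * (1 + 16 * (1 + Cχ) / (klScale klE0 m) * 1) + (2 ^ 10 * Φ * (4 : ℝ) ^ m))) * (1 + 6 / (klScale klE0 m) * ((klScale klE0 m) / 128 + X₀ * (R.Gfr 0 * |U| * Θ * ((16 : ℝ) ^ m)⁻¹)))))) ^ k) := by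
  have hδ0 : 0 ≤ (R.Gfr 0 * |U| * Θ * ((16 : ℝ) ^ m)⁻¹) := mul_nonneg (mul_nonneg (mul_nonneg (hR 0) (abs_nonneg U)) hΘ0) (by positivity)
  exact norm_iteratedFDeriv_J₁_le_gevrey (klScale_pos'' m) hω hX1 hC (fun l hl x => hXG l (hl.trans hk) x)
    (EngineV8.contDiff_frameLevel μ _) (contDiff_evalM _) (add_nonneg (by norm_num) (mul_nonneg (by positivity) hΞ0)) (mul_nonneg (mul_nonneg (by norm_num) hΦ0) (by positivity)) hδ0 hδΛ q
    (by have h0 := flowMismatch_jets_of_env hGS hQS hμ hX4 hP hT hmn hΘΦ 0 q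
        rw [norm_iteratedFDeriv_zero, Real.norm_eq_abs, Nat.factorial_zero, Nat.cast_one, mul_one, pow_zero, mul_one] at h0
        exact h0)
    (fun i hi1 _ => frameLevel_flowFrame_jets_of_env hR hGS hQS hμ hX4 hP hT hmn hΞ0 hΞ hi1 q)
    (fun i _ => flowMismatch_jets_of_env hGS hQS hμ hX4 hP hT hmn hΘΦ i q)

end Tables

end Summit.HubbardSuperconductivity.HubbardSuperconductivity.Theorems.EngineV8

end
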